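import Summits.ResolutionOfSingularities.ResolutionOfSingularities.Theorems.NearCutCompanion
import Literature.AlgebraicGeometry.Resolution.OrdZeroBasics
import HarnessLib

/-!
# NearCutCompanion2 — decomp-res node «NearCut» (lens-3 g22, critic row 170), tree file 5/10 of the node

Content VERBATIM from the decomp-res lens-3 g22 node `HOME/decomp-res-lens-3/g22/NearCut.lean` (pin 52e91527; HOME =
run/shared/lean/pub/decomp-res); critic row 170
BOOKED 0·0; landing orders INBOX :715 / :727 — provenance, critic text and the lens header in full in the first file
of the node, `NearCutForms`.  Namespace
`…Theorems.NearCut`; `--supports stmt-ResolutionOfSingularities-31770`; linear import chain in the lens's order.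

## This file

Continuation 2/3 of `NearCutCompanion` (same sections of the node, cut at the 400-line cap): carries `eval_aeval'`,
`constantCoeff_translate_chartTransform_zero` (via the landed `Rescue.ToricGuard.constantCoeff_translate`), `boundary_step`,
`homogeneousComponent_boundary_mul` (with the landed `Hauser2010.succ_le_ordZero_sub_homogeneousComponent`), `add_le_degree`,
`not_qpow_on_two_walls`, `coeff_mul_low`, `two_walls`, `near_of_structure`.

[WRITER NOTE (decomp-res writer g10): file split only (tree files ≤ 400 lines); namespace blocks, sections, section
variables, `open` lines and every declaration
exactly as in the lens; the three deprecated `Finsupp.degree_add` occurrences read `map_add` (definitionally the same lemma).]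

(Sources: cossart2020 (Cossart–Jannsen–Saito LNM 2270: Thm 5.40 p. 85, Defs 5.38/5.39 pp. 84–85, Thm 5.28 p. 72, Thm
5.35 / Cor 5.37); HauserPerlega2024 (Prop. 3 p. 791); Hauser2010Kangaroo (arXiv:0811.4151); Moh1987;
CossartPiltant2008 §2; Giraud1975; Hironaka1964.)
-/

noncomputable section

open MvPolynomial Finset
open Literature.AlgebraicGeometry.Resolution
open Literature.AlgebraicGeometry.Resolution.Hauser2010
open Literature.AlgebraicGeometry.Resolution.PointBlowup
open Summit.ResolutionOfSingularities.ResolutionOfSingularities.Theses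
open Summit.ResolutionOfSingularities.ResolutionOfSingularities.Theorems.TightDefectClasses
open Summit.ResolutionOfSingularities.ResolutionOfSingularities.Theorems.TightDefectStrongWalks
open Summit.ResolutionOfSingularities.ResolutionOfSingularities.Theorems.ItineraryCutClasses
open Summit.ResolutionOfSingularities.ResolutionOfSingularities.Theorems.BoundaryLedger
open Summit.ResolutionOfSingularities.ResolutionOfSingularities.Theorems.ProximityCut
open Summit.ResolutionOfSingularities.ResolutionOfSingularities.Theorems.ConeCutAxisLaw
open Literature.AlgebraicGeometry.Resolution.WeightedBlowup
open Literature.Barriers.ResolutionOfSingularities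
open Summit.ResolutionOfSingularities.ResolutionOfSingularities.Theorems.FloorCut
open Summit.ResolutionOfSingularities.ResolutionOfSingularities.Theorems.ConeCut
open Summit.ResolutionOfSingularities.ResolutionOfSingularities.Theorems.ExitLaw (fin3_cases eq_of_le_of_degree_le)
open Summit.ResolutionOfSingularities.ResolutionOfSingularities.Theorems.ShadeCut
open Summit.ResolutionOfSingularities.ResolutionOfSingularities.Theorems.TightCut
open Summit.ResolutionOfSingularities.ResolutionOfSingularities.Theorems.HoleCut

namespace Summit.ResolutionOfSingularities.ResolutionOfSingularities.Theorems.NearCut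

open Literature.AlgebraicGeometry.Resolution.HauserPerlega2024 (chartTransform_add chartTransform_monomial
  chartTransform_ne_zero)

section ChartAlgebra

variable {σ : Type*} [Fintype σ] [DecidableEq σ] {K : Type*} [Field K]

omit [Fintype σ] [DecidableEq σ] in
/-- Evaluation commutes with substitution. [folklore] -/
theorem eval_aeval' (x : σ → K) (g : σ → MvPolynomial σ K) (P : MvPolynomial σ K) :
    eval x (aeval g P) = eval (fun i => eval x (g i)) P := by
  have h : (eval x).comp (aeval g : MvPolynomial σ K →ₐ[K] MvPolynomial σ K).toRingHom
      = eval (fun i => eval x (g i)) := by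
    refine ringHom_ext (fun r => ?_) (fun i => ?_)
    · simp
    · simp
  exact congrArg (fun φ => φ P) (congrArg DFunLike.coe h)

omit [Fintype σ] in
/-- The boundary cofactor of a chart step: `translate b (cT_0 U)` has constant term `U(0)` (`b_j = 0`). [folklore] -/
theorem constantCoeff_translate_chartTransform_zero (j : σ) (b : σ → K) (hbj : b j = 0) (U : MvPolynomial σ K) :
    constantCoeff (translate b (chartTransform 0 j U)) = constantCoeff U := by
  rw [Rescue.ToricGuard.constantCoeff_translate, chartTransform_zero_eq_aeval, eval_aeval']
  have hfun : (fun i => eval b (if i = j then (X j : MvPolynomial σ K) else X j * X i)) = fun _ => 0 := by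
    funext i
    split_ifs with h
    · rw [eval_X, hbj]
    · rw [map_mul, eval_X, hbj, zero_mul]
  rw [hfun, eval_zero']

/-- **THE BOUNDARY FACTOR OF A CHART STEP (PROVED).**  `translate b (cT_δ (y^r · U)) = y^{r'} · U'` with
`r' = (r|_{b=0})[j ↦ |r| − δ]` and `U'(0) ≠ 0`, for `δ ≤ |r|`, `U(0) ≠ 0`, `b_j = 0`. [folklore] -/
theorem boundary_step [DecidableEq K] (j : σ) (b : σ → K) (hbj : b j = 0) (r : σ →₀ ℕ) {δ : ℕ} (hδ : δ ≤ r.degree)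
    {U : MvPolynomial σ K} (hU : constantCoeff U ≠ 0) :
    ∃ U' : MvPolynomial σ K, constantCoeff U' ≠ 0 ∧
      translate b (chartTransform δ j (monomial r 1 * U))
        = monomial ((r.filter (fun l => b l = 0)).update j (r.degree - δ)) 1 * U' := by
  classical
  have hr : (δ : ℕ∞) ≤ ordZero (monomial r (1 : K)) := by
    rw [ordZero_monomial r one_ne_zero]; exact_mod_cast hδ
  have hU0 : ((0 : ℕ) : ℕ∞) ≤ ordZero U := by simp
  rw [show δ = δ + 0 by simp, chartTransform_mul_of_le j hr hU0, Nat.add_zero, chartTransform_monomial,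
    Rescue.ToricGuard.translate_mul_comm]
  -- the monomial factor
  have hexp : chartExponent δ j r = r.update j 0 + Finsupp.single j (r.degree - δ) := by
    ext i
    rw [chartExponent_apply, Finsupp.add_apply, Finsupp.update_apply, Finsupp.single_apply]
    by_cases hij : i = j
    · subst hij; simp
    · rw [if_neg hij, if_neg hij, if_neg (Ne.symm hij), add_zero]
  have hmono : monomial (chartExponent δ j r) (1 : K) = monomial (r.update j 0) 1 * X j ^ (r.degree - δ) := by
    rw [hexp, X_pow_eq_monomial, monomial_mul, one_mul]
  rw [hmono, Rescue.ToricGuard.translate_mul_comm, translate_X_pow_self b hbj, translate_boundary_split j b hbj r]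
  refine ⟨translate b (monomial (r.filter (fun l => b l ≠ 0)) 1) * translate b (chartTransform 0 j U), ?_, ?_⟩
  · rw [map_mul, constantCoeff_translate_chartTransform_zero j b hbj]
    exact mul_ne_zero (coeff_zero_translate_boundary_ne_zero b r) hU
  · have hexp2 : (r.filter (fun l => b l = 0)).update j (r.degree - δ)
        = ((r.filter (fun l => b l = 0)).erase j) + Finsupp.single j (r.degree - δ) := by
      rw [Finsupp.update_eq_erase_add_single]
    rw [hexp2, show monomial (((r.filter (fun l => b l = 0)).erase j) + Finsupp.single j (r.degree - δ)) (1 : K)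
        = monomial ((r.filter (fun l => b l = 0)).erase j) 1 * X j ^ (r.degree - δ) by
      rw [X_pow_eq_monomial, monomial_mul, one_mul]]
    ring

end ChartAlgebra

section Layers

variable {σ : Type*} [Fintype σ] [DecidableEq σ] {K : Type*} [Field K]

/-- **THE LOWEST LAYER OF `y^r · U · G`**: `in_{|r|+g}(y^r U G) = y^r · U(0) · in_g(G)` when `g ≤ ord G`. [folklore] -/
theorem homogeneousComponent_boundary_mul (r : σ →₀ ℕ) (U : MvPolynomial σ K) {G : MvPolynomial σ K} {g : ℕ}
    (hG : (g : ℕ∞) ≤ ordZero G) :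
    homogeneousComponent (r.degree + g) (monomial r 1 * U * G)
      = monomial r 1 * (C (constantCoeff U) * homogeneousComponent g G) := by
  classical
  -- coefficients of `U * G` in degree `g`
  have hlow : ∀ m : σ →₀ ℕ, m.degree = g → coeff m (U * G) = constantCoeff U * coeff m G := by
    intro m hm
    have hsplit : U * G = U * homogeneousComponent g G + U * (G - homogeneousComponent g G) := by ring
    rw [hsplit, coeff_add, coeff_mul_of_isHomogeneous U _ (homogeneousComponent_isHomogeneous g G) m hm,
      coeff_homogeneousComponent, if_pos hm]
    have htail : coeff m (U * (G - homogeneousComponent g G)) = 0 := by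
      apply coeff_eq_zero_of_degree_lt_ordZero
      refine lt_of_lt_of_le ?_ (le_trans (Hauser2010.succ_le_ordZero_sub_homogeneousComponent hG) (le_ordZero_mul_left U _))
      exact_mod_cast (show m.degree < g + 1 by omega)
    rw [htail, add_zero]
    rfl
  ext d
  rw [coeff_homogeneousComponent, mul_assoc, coeff_monomial_mul', coeff_monomial_mul']
  split_ifs with hdeg hle hle'
  · have hm : (d - r).degree = g := by rw [degree_tsub_of_le hle]; omega
    rw [one_mul, one_mul, hlow _ hm, coeff_C_mul, coeff_homogeneousComponent, if_pos hm]
  · rfl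
  · rw [one_mul, coeff_C_mul, coeff_homogeneousComponent, if_neg, mul_zero]
    rw [degree_tsub_of_le hle']
    have := degree_le_degree_of_le hle'
    omega
  · rfl

omit [DecidableEq σ] in
/-- Two coordinates are bounded by the degree. [folklore] -/
theorem add_le_degree {y₁ y₂ : σ} (h : y₁ ≠ y₂) (m : σ →₀ ℕ) : m y₁ + m y₂ ≤ m.degree := by
  classical
  have h1 := PointBlowup.degree_eq_add_sum_erase y₁ m
  have h2 : m y₂ ≤ ∑ i ∈ Finset.univ.erase y₁, m i :=
    Finset.single_le_sum (fun k _ => Nat.zero_le (m k)) (Finset.mem_erase.mpr ⟨h.symm, Finset.mem_univ y₂⟩)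
  omega

omit [Fintype σ] [DecidableEq σ] in
/-- **NO `q`-TH POWER SITS ON TWO WALLS OF HEIGHT `δ` BELOW DEGREE `2s`** (`δ + s = q`, `0 < δ`). [new] [folklore] -/
theorem not_qpow_on_two_walls [Fintype σ] {q δ s : ℕ} (hq : δ + s = q) (hδ : 0 < δ) {r m : σ →₀ ℕ} {y₁ y₂ : σ}
    (hy : y₁ ≠ y₂) (h1 : r y₁ = δ) (h2 : r y₂ = δ) (hm : m.degree < 2 * s) : ¬ ∀ i, q ∣ (r + m) i := by
  intro hdiv
  have hw : ∀ y, r y = δ → s ≤ m y := by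
    intro y hy
    have hd := hdiv y
    rw [Finsupp.add_apply, hy] at hd
    have hpos : 0 < δ + m y := by omega
    have := Nat.le_of_dvd hpos hd
    omega
  have := add_le_degree hy m
  have := hw y₁ h1
  have := hw y₂ h2
  omega

end Layers

open Literature.AlgebraicGeometry.Resolution.HauserPerlega2024 (chartTransform_add)

section LowCoeff

variable {σ : Type*} [Fintype σ] [DecidableEq σ] {K : Type*} [Field K]

/-! ### §N4b The companion law along a δ-balanced plateau (PROVED). -/

omit [Fintype σ] in
/-- The lowest coefficients of `U · G`: `coeff_m (U G) = U(0) · coeff_m G` for `|m| = g ≤ ord G`. [folklore] -/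
theorem coeff_mul_low (U : MvPolynomial σ K) {G : MvPolynomial σ K} {g : ℕ} (hG : (g : ℕ∞) ≤ ordZero G)
    (m : σ →₀ ℕ) (hm : m.degree = g) : coeff m (U * G) = constantCoeff U * coeff m G := by
  classical
  have hsplit : U * G = U * homogeneousComponent g G + U * (G - homogeneousComponent g G) := by ring
  rw [hsplit, coeff_add, coeff_mul_of_isHomogeneous U _ (homogeneousComponent_isHomogeneous g G) m hm,
    coeff_homogeneousComponent, if_pos hm]
  have htail : coeff m (U * (G - homogeneousComponent g G)) = 0 := by
    apply coeff_eq_zero_of_degree_lt_ordZero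
    refine lt_of_lt_of_le ?_ (le_trans (Hauser2010.succ_le_ordZero_sub_homogeneousComponent hG) (le_ordZero_mul_left U _))
    exact_mod_cast (show m.degree < g + 1 by omega)
  rw [htail, add_zero]
  rfl

end LowCoeff

section Structure

variable {K : Type} [Field K] [DecidableEq K]

/-- Off the zero coordinate a balanced boundary has two walls of height `q − s`. [folklore] -/
theorem two_walls {r : Fin 3 →₀ ℕ} {s q : ℕ} (h : ∃ x, r x = 0 ∧ ∀ y, y ≠ x → r y + s = q) :
    ∃ y₁ y₂ : Fin 3, y₁ ≠ y₂ ∧ r y₁ = q - s ∧ r y₂ = q - s := by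
  obtain ⟨x, -, hx⟩ := h
  have hthree : ∀ x : Fin 3, ∃ y₁ y₂ : Fin 3, y₁ ≠ x ∧ y₂ ≠ x ∧ y₁ ≠ y₂ := by decide
  obtain ⟨y₁, y₂, h1, h2, h12⟩ := hthree x
  exact ⟨y₁, y₂, h12, by have := hx y₁ h1; omega, by have := hx y₂ h2; omega⟩

omit [DecidableEq K] in
/-- **NEAR (kernel form).**  If `F = y^r·U·G + C` is cleaned, `U(0) ≠ 0`, `C ∈ K[y^q]`, `ord F = |r| + s`, and `r` has
two walls of height `δ = q − s > 0`, then `ord G = s`: a drop of the order of `G` would put a monomial of `C` on the two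
walls below degree `2s`, a rise would make the initial form of `F` a `q`-th power. [new] [folklore] -/
theorem near_of_structure {q δ s : ℕ} (hδs : δ + s = q) (hδ : 0 < δ)
    {F U G Cq : MvPolynomial (Fin 3) K} {r : Fin 3 →₀ ℕ}
    (hclean : deletePthPowers q F = F) (hU : constantCoeff U ≠ 0) (hCq : IsQPoly q Cq)
    (hF : F = monomial r 1 * U * G + Cq) (hoF : ordZero F = ((r.degree + s : ℕ) : ℕ∞))
    {y₁ y₂ : Fin 3} (hy : y₁ ≠ y₂) (h1 : r y₁ = δ) (h2 : r y₂ = δ) :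
    ordZero G = (s : ℕ∞) := by
  classical
  rcases lt_trichotomy (ordZero G) (s : ℕ∞) with hlt | heq | hgt
  · exfalso
    have hG0 : G ≠ 0 := by
      intro h; rw [h, ordZero_eq_top_iff.mpr rfl] at hlt; exact not_top_lt hlt
    obtain ⟨g, hg⟩ := exists_ordZero_eq_natCast hG0
    have hgs : g < s := by rw [hg] at hlt; exact_mod_cast hlt
    obtain ⟨⟨m, hm, hmdeg⟩, -⟩ := (ordZero_eq_nat_iff G g).mp hg
    have hdeg : (r + m).degree < r.degree + s := by rw [map_add]; omega
    have hcF : coeff (r + m) F = 0 :=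
      coeff_eq_zero_of_degree_lt_ordZero (by rw [hoF]; exact_mod_cast hdeg)
    have hcA : coeff (r + m) (monomial r 1 * U * G) = constantCoeff U * coeff m G := by
      rw [mul_assoc, coeff_monomial_mul', if_pos le_self_add, one_mul, add_tsub_cancel_left,
        coeff_mul_low U hg.ge m hmdeg]
    have hcC : coeff (r + m) Cq ≠ 0 := by
      have h := congrArg (coeff (r + m)) hF
      rw [coeff_add, hcF, hcA] at h
      intro h0
      rw [h0, add_zero] at h
      exact mul_ne_zero hU hm h.symm
    exact not_qpow_on_two_walls hδs hδ hy h1 h2 (by omega : m.degree < 2 * s) (hCq _ hcC)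
  · exact heq
  · exfalso
    obtain ⟨⟨d, hd, hddeg⟩, -⟩ := (ordZero_eq_nat_iff F (r.degree + s)).mp hoF
    have hcA : coeff d (monomial r 1 * U * G) = 0 := by
      rw [mul_assoc, coeff_monomial_mul']
      split_ifs with hle
      · rw [one_mul]
        apply coeff_eq_zero_of_degree_lt_ordZero
        refine lt_of_lt_of_le ?_ (le_ordZero_mul_left U G)
        rw [degree_tsub_of_le hle]
        have : ((d.degree - r.degree : ℕ) : ℕ∞) = (s : ℕ∞) := by congr 1; omega
        rw [this]; exact hgt
      · rfl
    have hcC : coeff d Cq = coeff d F := by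
      have h := congrArg (coeff d) hF
      rw [coeff_add, hcA, zero_add] at h
      exact h.symm
    have hq : ∀ i, q ∣ d i := hCq d (by rw [hcC]; exact hd)
    exact hd (coeff_eq_zero_of_clean hclean hq)

end Structure

end Summit.ResolutionOfSingularities.ResolutionOfSingularities.Theorems.NearCut
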